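import Summits.BirchSwinnertonDyer.BirchSwinnertonDyer.Theses.ByReductionTypeAtTwo
import Summits.BirchSwinnertonDyer.BirchSwinnertonDyer.Theorems.ByReductionTypeAtTwoSupersingularLine
import HarnessLib

/-!
# Route `ByReductionTypeAtTwo` (rung K4), crux `SupersingularRankZeroAtTwo` (item
# stmt-BirchSwinnertonDyer-19097): the ODD sign at `p = 2` — the local-defect exponent `d` that B. D.
# Kim's Euler characteristic must carry for `X⁻(E/ℚ_∞)` at `2`, and why the line uses the EVEN sign
# (helper, seat `bsd-2adic-ss-1` GEN 4)

HONEST FRAMING (cell `bsd-2adic`, HUMAN RULINGS D-0036/D-0059/D-0074): THEOREMS ONLY, every research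
input an explicit hypothesis on the tree's REAL objects (`SignedSelmerDualData W κ γ (-1)` = `X⁻(E/ℚ_∞)`,
the Pollack pair at `2`, `kobayashiL (-1) L⁺ L⁻ = L⁺ = L♯`); no definition, no named fact, nothing
asserted about any curve, nothing booked. PARTITION (D-0054): X5@2 good-ss (B1·O1; `a₂ = 0` sub-row,
208 of 757 r0 classes) × `p = 2` — types-the-object-of (a kernel-checked TYPED OBSTRUCTION for the odd
sign); closes none.

The line `signed-halves-two` (v3) runs `a₂ = 0` through the EVEN sign: `X⁺` against `L♭ = kobayashiL 1`,
whose constant term at `2` is `1 · L(E,1)/Ω_E` (`c♭ = 1`), with Kim's Cor. 3.15 read VERBATIM at `2`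
(`ByReductionTypeAtTwoSupersingularHalvesTwo`). This file runs the SAME bookkeeping for the ODD sign:
`X⁻` against `L♯ = kobayashiL (-1)`, whose constant term at `2`, `a₂ = 0`, is `c♯ · [0]⁺_f` with
**`c♯ = −4`** (`constantCoeff_sharp_two_of_isSprungPair_of_isNewformOf`; Kurihara–Otsuki 2006 Rem. 0.2
(3): "`g(0) = 4L(E,1)/Ω_E`"), and with Kim's identity carrying an explicit LOCAL-DEFECT exponent `d`
at the prime `2`: `g(0) = u · 2^{d + v₂ ∏c_ℓ} · #Sel_{2^∞}(E/ℚ)` (`d = 0` is the printed odd-`p` shape;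
in Kim's proof `2^d = #ker g_p`, `g_p` the bottom-layer local map at `p`, injective for odd `p` by
Kobayashi Prop. 8.23/8.24 `(E^±(k_∞) ⊗ ℚ_p/ℤ_p)^∨ ≅ Λ`, Kim Prop. 2.2/2.3 and p. 200).

* `valuation_constantCoeff_of_kimDefect_two` — (K_d) in valuations: `v₂ g(0) = d + v₂∏c + v₂#Ш`.
* `exists_generator_of_oddSignedDivisibility_two` — odd twin of `exists_generator_of_signedDivisibility_two`:
  from ONE odd-sign divisibility at `2`, `g(0) = −4t·h(0)` (lower shape) or `g(0)·h(0) = −4t` (upper).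
* `shaOrder_val_of_oddSignedHalves_two` — BOTH odd-sign divisibilities at `2` + Kobayashi 1.2⁻ at `2` +
  (K_d) ⇒ **`v₂ #Ш + d = v₂ #Ш_an + 2`**.
* `not_bsdp_two_of_oddSignedHalves_two` — hence **`d ≠ 2 ⇒ ¬ BSDp W 2`**; in particular the VERBATIM
  odd package (`d = 0`) contradicts the crux: `false_of_supersingularRankZeroAtTwo_of_oddSignVerbatim_two`.
* `supersingularRankZeroAtTwo_of_oddSignedHalves_two` — the odd-sign DOOR: the crux from PUB + the odd
  package WITH `d = 2` on `a₂ = 0` + the Miller halves on `a₂ = ±2` (class-level, ∀-closed).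

So at `2` the even and odd packages are NOT interchangeable transcriptions of the odd-`p` literature: the
odd side needs exactly one extra factor `4` — analytically Sprung's/KO's `c♯ = −4`, algebraically a local
defect `#D⁻ = 2^d = 4`, `D^ε := (E^ε(ℚ_{2,∞}) ⊗ ℚ₂/ℤ₂)^Γ/(E(ℚ₂) ⊗ ℚ₂/ℤ₂) = lim→ H¹(Gal(ℚ_{2,n}/ℚ₂), E^ε(ℚ_{2,n}))`.
COMPUTED EVIDENCE (exact integer linear algebra on the Honda formal group of type `2 − a₂T + T²` over
the layers `ℚ_{2,n}` of the cyclotomic `ℤ₂`-extension of `ℚ₂`; kit jobs j253754 / j253870 attached to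
the item; the control `p = 3` gives `D^± = 0` at every layer tested, as Kim's proof requires): for
`a₂ = 0`, `#H¹(Gal(ℚ_{2,n}/ℚ₂), E⁺(ℚ_{2,n})) = 1` for `n ≤ 6` (EVEN: no defect) and
`#H¹(Gal(ℚ_{2,n}/ℚ₂), E⁻(ℚ_{2,n})) = 2, 2, 4, 4, 4, 4` (ODD: `D⁻ ≅ ℤ/4`, i.e. `d = 2` — the value this
file shows BSD₂ requires).

References: [Kobayashi2003] Def. 1.1, Thm. 1.2, Thm. 4.1, Prop. 8.23/8.24, (3.6); [BDKim2013] Prop. 2.2,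
2.3, Cor. 3.15 (p. 199), proof p. 200; [Sprung2017] Cor. 4.11 (row `p = 2`); [KuriharaOtsuki2006]
Rem. 0.2 (3), Prop. 1.4; [Miller2011LMS] Def. 1.1.
-/

set_option autoImplicit false
-- the Theorems namespace of this sub repeats the summit name by design (D-0017 nested layout)
set_option linter.dupNamespace false

noncomputable section

open scoped Classical MatrixGroups ModularForm

open CongruenceSubgroup WeierstrassCurve Literature.NumberTheory.EllipticCurves
  Literature.NumberTheory.EllipticCurves.ModularForms Literature.NumberTheory.EllipticCurves.Sprung2017
  Literature.NumberTheory.EllipticCurves.Rank1Residual Literature.NumberTheory.EllipticCurves.Rank1Residual.Typed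
  Literature.NumberTheory.EllipticCurves.Kobayashi2003 ZpExtension
  Summit.BirchSwinnertonDyer.Rank1Residual Summit.BirchSwinnertonDyer.Rank1Residual.Supersingular

namespace Summit.BirchSwinnertonDyer.BirchSwinnertonDyer.Theorems

section OddSign

variable (W : WeierstrassCurve ℚ) [W.IsElliptic] [W.IsGloballyMinimal]

omit [W.IsGloballyMinimal] in
/-- **(K_d) read in valuations.** In analytic rank `0` (GZK: `#Sel_{2^∞}(E/ℚ) = #Ш[2^∞]`), Kim's identity WITH
a local-defect exponent `d` at `2`, `g(0) = u · 2^{d + v₂ ∏c_ℓ} · #Sel_{2^∞}(E/ℚ)`, gives `g(0) ≠ 0` and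
`v₂ g(0) = d + v₂ ∏c_ℓ + v₂ #Ш` (`d = 0`: the tree's `valuation_constantCoeff_xi`). [cite: BDKim2013, Cor. 3.15 (p. 199)] -/
theorem valuation_constantCoeff_of_kimDefect_two
    (hGZK : rank_eq_analyticRank_of_analyticRank_le_one) (hL : W.entireLFunction 1 ≠ 0)
    (d : ℕ) (g : IwasawaAlgebra 2)
    (hK : Finite (W.selmerGroupPInfty 2) →
      ∃ u : ℤ_[2]ˣ, ((PowerSeries.constantCoeff g : ℤ_[2]) : ℚ_[2]) =
        ((u : ℤ_[2]) : ℚ_[2]) * ((2 : ℕ) : ℚ_[2]) ^ (d + padicValNat 2 W.tamagawaProduct) *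
          (Nat.card (W.selmerGroupPInfty 2) : ℚ_[2])) :
    ((PowerSeries.constantCoeff g : ℤ_[2]) : ℚ_[2]) ≠ 0 ∧
      (((PowerSeries.constantCoeff g : ℤ_[2]) : ℚ_[2])).valuation =
        (d : ℤ) + (padicValNat 2 W.tamagawaProduct : ℤ) + padicValNat 2 W.shaOrder := by
  have hr : W.analyticRank = 0 := analyticRank_eq_zero_of_entireLFunction_one_ne_zero W hL
  have hr0 : W.mordellWeilRank = 0 := (hGZK W (by omega)).1.trans hr
  haveI hfinE : Finite W.toAffine.Point := W.mordellWeilRank_eq_zero_iff_finite.mp hr0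
  haveI hfinSha : Finite W.sha := (hGZK W (by omega)).2
  have hSel : Nat.card (W.selmerGroupPInfty 2) =
      Nat.card (AddCommGroup.primaryComponent W.sha 2) :=
    W.natCard_selmerGroupPInfty_eq_natCard_primaryComponent_sha 2
  have hcardpos : 0 < Nat.card (AddCommGroup.primaryComponent W.sha 2) := Nat.card_pos
  have hSelfin : Finite (W.selmerGroupPInfty 2) :=
    Nat.finite_of_card_ne_zero (by rw [hSel]; exact hcardpos.ne')
  obtain ⟨u, hu⟩ := hK hSelfin
  have hpow : (((2 : ℕ) : ℚ_[2]) ^ (d + padicValNat 2 W.tamagawaProduct)) =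
      ((2 ^ (d + padicValNat 2 W.tamagawaProduct) : ℕ) : ℚ_[2]) := by norm_cast
  rw [hpow, hSel] at hu
  have hS0 : ((Nat.card (AddCommGroup.primaryComponent W.sha 2) : ℕ) : ℚ_[2]) ≠ 0 := by
    exact_mod_cast hcardpos.ne'
  have hP0 : ((2 ^ (d + padicValNat 2 W.tamagawaProduct) : ℕ) : ℚ_[2]) ≠ 0 := by
    exact_mod_cast pow_ne_zero _ two_ne_zero
  have hne : ((PowerSeries.constantCoeff g : ℤ_[2]) : ℚ_[2]) ≠ 0 := by
    rw [hu]; exact mul_ne_zero (mul_ne_zero (coe_units_ne_zero 2 u) hP0) hS0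
  refine ⟨hne, ?_⟩
  have h := congrArg Padic.valuation hu
  rw [Padic.valuation_mul (mul_ne_zero (coe_units_ne_zero 2 u) hP0) hS0,
    Padic.valuation_mul (coe_units_ne_zero 2 u) hP0, valuation_coe_units_eq_zero,
    Padic.valuation_natCast, Padic.valuation_natCast, padicValNat.prime_pow,
    padicValNat_card_addPrimaryComponent (A := W.sha) 2] at h
  rw [h, WeierstrassCurve.shaOrder]
  push_cast
  ring

/-- **Odd-sign bookkeeping at `a₂ = 0`, `p = 2`** (the `ε = −1` twin of `exists_generator_of_signedDivisibility_two`):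
from modularity, Kobayashi 1.2 for `X⁻` at `2` (`h12`), Kim's identity with local-defect exponent `d` (`hKim`) and ONE
odd-sign divisibility at `2` over every Pollack pair (`hdiv`; lower shape `ι g = ϖ·ι(L♯·h)`, upper shape
`ι(g·h) = ϖ·ι L♯`, `L♯ = kobayashiL (-1)`): `t = L(E,1)/Ω_E ≠ 0`, a generator `g` of `char X⁻` with
`v₂ g(0) = d + v₂∏c + v₂#Ш`, and `h` with `g(0) = (−4t)·h(0)` resp. `g(0)·h(0) = −4t` (`c♯ = −4` at `a₂ = 0`).
[cite: Sprung2017, Cor. 4.11 (row p = 2)] [cite: BDKim2013, Cor. 3.15 (p. 199)] -/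
theorem exists_generator_of_oddSignedDivisibility_two
    (hmod : nonempty_modularParametrizationData) (hGZK : rank_eq_analyticRank_of_analyticRank_le_one)
    (hgood : W.HasGoodReductionAtPrime 2) (ha : W.frobeniusTrace 2 = 0) (hL : W.entireLFunction 1 ≠ 0)
    (h12 : ∀ (κ : ZpExtension ℚ 2) (γ : Field.absoluteGaloisGroup ℚ), κ.IsCyclotomic → κ.IsTopGenerator γ →
      ∀ D : SignedSelmerDualData W κ γ (-1), Module.Finite (IwasawaAlgebra 2) D.X ∧ Module.IsTorsion (IwasawaAlgebra 2) D.X)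
    (d : ℕ)
    (hKim : ∀ (κ : ZpExtension ℚ 2) (γ : Field.absoluteGaloisGroup ℚ), κ.IsCyclotomic → κ.IsTopGenerator γ →
      ∀ (D : SignedSelmerDualData W κ γ (-1)) [Module.Finite (IwasawaAlgebra 2) D.X], Module.IsTorsion (IwasawaAlgebra 2) D.X →
      ∀ g : IwasawaAlgebra 2, D.charIdeal = Ideal.span {g} → Finite (W.selmerGroupPInfty 2) →
        ∃ u : ℤ_[2]ˣ, ((PowerSeries.constantCoeff g : ℤ_[2]) : ℚ_[2]) = ((u : ℤ_[2]) : ℚ_[2]) *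
          ((2 : ℕ) : ℚ_[2]) ^ (d + padicValNat 2 W.tamagawaProduct) * (Nat.card (W.selmerGroupPInfty 2) : ℚ_[2]))
    (low : Bool)
    (hdiv : ∀ (κ : ZpExtension ℚ 2) (γ : Field.absoluteGaloisGroup ℚ),
      κ.IsCyclotomic → κ.IsTopGenerator γ → IsCyclotomicVariable 2 γ →
      ∀ [NeZero (W.conductorNorm ℤ)] (f : CuspForm (Gamma0 (W.conductorNorm ℤ)) 2),
        IsNewformOf W f → ∀ (ϖ : ℚ), (ϖ : ℝ) * W.realPeriodRat = plusPeriod f →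
      ∀ (Lplus Lminus : IwasawaAlgebra 2), IsPollackPair f 2 Lplus Lminus →
      ∀ (D : SignedSelmerDualData W κ γ (-1)),
        ∃ g h : IwasawaAlgebra 2, D.charIdeal = Ideal.span {g} ∧
          (if low then iwasawaToPowerSeries 2 g =
              PowerSeries.C (ϖ : ℚ_[2]) * iwasawaToPowerSeries 2 (kobayashiL (-1) Lplus Lminus * h)
           else iwasawaToPowerSeries 2 (g * h) =
              PowerSeries.C (ϖ : ℚ_[2]) * iwasawaToPowerSeries 2 (kobayashiL (-1) Lplus Lminus))) :
    ∃ t : ℚ, t ≠ 0 ∧ W.entireLFunction 1 / (W.realPeriodRat : ℂ) = (t : ℂ) ∧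
      ∃ g h : IwasawaAlgebra 2,
        (((PowerSeries.constantCoeff g : ℤ_[2]) : ℚ_[2])).valuation =
          (d : ℤ) + (padicValNat 2 W.tamagawaProduct : ℤ) + padicValNat 2 W.shaOrder ∧
        ((PowerSeries.constantCoeff g : ℤ_[2]) : ℚ_[2]) ≠ 0 ∧
        (if low then ((PowerSeries.constantCoeff g : ℤ_[2]) : ℚ_[2]) =
            ((((-4 : ℚ) * t : ℚ) : ℚ_[2])) * ((PowerSeries.constantCoeff h : ℤ_[2]) : ℚ_[2])
         else ((PowerSeries.constantCoeff g : ℤ_[2]) : ℚ_[2]) *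
            ((PowerSeries.constantCoeff h : ℤ_[2]) : ℚ_[2]) = ((((-4 : ℚ) * t : ℚ) : ℚ_[2]))) := by
  -- modularity: the newform `f` of `E` and the period ratio `ϖ`
  haveI : NeZero (W.conductorNorm ℤ) := ⟨(W.conductorNorm_pos_holds).ne'⟩
  obtain ⟨Dm⟩ := hmod W
  set f := Dm.f with hf_def
  have hf : IsNewformOf W f := Dm.isNewformOf
  obtain ⟨ϖ, hϖpos, hϖeq, hΩpos⟩ := Dm.exists_rat_mul_realPeriodRat_eq_plusPeriod
  set s : ℚ := ratPlusSymbol f 0 with hs_def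
  set t : ℚ := ϖ * s with ht_def
  have hLval : W.entireLFunction 1 = (((s : ℝ) * plusPeriod f : ℝ) : ℂ) := hf.entireLFunction_one_eq
  have ht : W.entireLFunction 1 / (W.realPeriodRat : ℂ) = ((t : ℚ) : ℂ) := by
    rw [hLval, ← hϖeq, div_eq_iff (Complex.ofReal_ne_zero.mpr hΩpos.ne'), ht_def]
    push_cast
    ring
  have hs0 : s ≠ 0 := by
    intro h0
    apply hL
    rw [hLval, h0]
    simp
  have ht0 : t ≠ 0 := mul_ne_zero hϖpos.ne' hs0
  -- cyclotomic data, the Pollack pair at `2`, the dual datum of `Sel⁻(E/ℚ_∞)`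
  obtain ⟨κ, hκ, γ, hγ, hγ'⟩ := exists_isCyclotomic_isTopGenerator_isCyclotomicVariable_holds 2
  obtain ⟨Ls, Lf, hSP, hPP⟩ := exists_isPollackPair_two hf hgood ha hL
  obtain ⟨D⟩ := nonempty_signedSelmerDualData W κ (-1 : ℤˣ) hγ
  obtain ⟨hFin, hTors⟩ := h12 κ γ hκ hγ D
  haveI := hFin
  obtain ⟨g, h, hchar, hgh⟩ := hdiv κ γ hκ hγ hγ' f hf ϖ hϖeq Ls Lf hPP D
  have hkL : kobayashiL (-1 : ℤˣ) Ls Lf = Ls := by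
    unfold kobayashiL; rw [if_neg (by decide)]
  rw [hkL] at hgh
  -- Kim with defect `d` at `2` for `g`
  obtain ⟨hg0ne, hvg⟩ := valuation_constantCoeff_of_kimDefect_two W hGZK hL d g
    (fun hfin ↦ hKim κ γ hκ hγ D hTors g hchar hfin)
  -- the `♯` constant at `2`, `a₂ = 0`: `L♯(0) = −4·[0]⁺_f`, so `ϖ · L♯(0) = −4t`
  have hLs0 := constantCoeff_sharp_two_of_isSprungPair_of_isNewformOf hf hgood hSP
  rw [ha] at hLs0
  have hϖLs : (ϖ : ℚ_[2]) * ((PowerSeries.constantCoeff Ls : ℤ_[2]) : ℚ_[2]) =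
      ((((-4 : ℚ) * t : ℚ) : ℚ_[2])) := by
    rw [hLs0, ht_def]
    push_cast
    ring
  refine ⟨t, ht0, ht, g, h, hvg, hg0ne, ?_⟩
  cases low with
  | true =>
    simp only [if_true] at hgh ⊢
    have hc := congrArg PowerSeries.constantCoeff hgh
    rw [constantCoeff_iwasawaToPowerSeries, map_mul, PowerSeries.constantCoeff_C,
      constantCoeff_iwasawaToPowerSeries, map_mul, PadicInt.coe_mul, ← mul_assoc, hϖLs] at hc
    exact hc
  | false =>
    simp only [Bool.false_eq_true, if_false] at hgh ⊢
    have hc := congrArg PowerSeries.constantCoeff hgh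
    rw [constantCoeff_iwasawaToPowerSeries, map_mul, PadicInt.coe_mul, map_mul,
      PowerSeries.constantCoeff_C, constantCoeff_iwasawaToPowerSeries, hϖLs] at hc
    exact hc

/-- **The odd-sign valuation identity at `a₂ = 0`, `p = 2`.** PUB {modularity, GZK} + typed {Kobayashi 1.2 for `X⁻`
at `2` (`h12`), Kim's identity with local-defect exponent `d` (`hKim`), `KobayashiLowerDivisibility W 2 (-1)` (`hlow`),
the odd Kato-side divisibility at `2` (`hup`)} ⇒ **`v₂ #Ш + d = v₂ #Ш_an + 2`** (`#Ш_an = q = t·#tors²/∏c`): the two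
divisibilities pin `v₂ g(0) = 2 + v₂ t` (`c♯ = −4`), (K_d) gives `v₂ g(0) = d + v₂∏c + v₂#Ш`, and `2 ∤ #E(ℚ)_tors`.
[cite: Sprung2017, Cor. 4.11 (row p = 2)] [cite: BDKim2013, Cor. 3.15 (p. 199)] [cite: Miller2011LMS, Def. 1.1] -/
theorem shaOrder_val_of_oddSignedHalves_two
    (hmod : nonempty_modularParametrizationData) (hGZK : rank_eq_analyticRank_of_analyticRank_le_one)
    (hgood : W.HasGoodReductionAtPrime 2) (ha : W.frobeniusTrace 2 = 0) (hL : W.entireLFunction 1 ≠ 0)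
    (h12 : ∀ (κ : ZpExtension ℚ 2) (γ : Field.absoluteGaloisGroup ℚ), κ.IsCyclotomic → κ.IsTopGenerator γ →
      ∀ D : SignedSelmerDualData W κ γ (-1), Module.Finite (IwasawaAlgebra 2) D.X ∧ Module.IsTorsion (IwasawaAlgebra 2) D.X)
    (d : ℕ)
    (hKim : ∀ (κ : ZpExtension ℚ 2) (γ : Field.absoluteGaloisGroup ℚ), κ.IsCyclotomic → κ.IsTopGenerator γ →
      ∀ (D : SignedSelmerDualData W κ γ (-1)) [Module.Finite (IwasawaAlgebra 2) D.X], Module.IsTorsion (IwasawaAlgebra 2) D.X →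
      ∀ g : IwasawaAlgebra 2, D.charIdeal = Ideal.span {g} → Finite (W.selmerGroupPInfty 2) →
        ∃ u : ℤ_[2]ˣ, ((PowerSeries.constantCoeff g : ℤ_[2]) : ℚ_[2]) = ((u : ℤ_[2]) : ℚ_[2]) *
          ((2 : ℕ) : ℚ_[2]) ^ (d + padicValNat 2 W.tamagawaProduct) * (Nat.card (W.selmerGroupPInfty 2) : ℚ_[2]))
    (hlow : KobayashiLowerDivisibility W 2 (-1))
    (hup : ∀ (κ : ZpExtension ℚ 2) (γ : Field.absoluteGaloisGroup ℚ),
      κ.IsCyclotomic → κ.IsTopGenerator γ → IsCyclotomicVariable 2 γ →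
      ∀ [NeZero (W.conductorNorm ℤ)] (f : CuspForm (Gamma0 (W.conductorNorm ℤ)) 2), IsNewformOf W f →
      ∀ (ϖ : ℚ), (ϖ : ℝ) * W.realPeriodRat = plusPeriod f → ∀ (Lplus Lminus : IwasawaAlgebra 2), IsPollackPair f 2 Lplus Lminus →
      ∀ (D : SignedSelmerDualData W κ γ (-1)), ∃ g h : IwasawaAlgebra 2, D.charIdeal = Ideal.span {g} ∧
        iwasawaToPowerSeries 2 (g * h) = PowerSeries.C (ϖ : ℚ_[2]) * iwasawaToPowerSeries 2 (kobayashiL (-1) Lplus Lminus)) :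
    ∃ q : ℚ, shaAn W = (q : ℂ) ∧ padicValRat 2 q + 2 = (padicValNat 2 W.shaOrder : ℤ) + d := by
  have hr : W.analyticRank = 0 := analyticRank_eq_zero_of_entireLFunction_one_ne_zero W hL
  have hirr : W.HasIrreducibleModPGaloisRep 2 :=
    P2.irr_two_of_goodSS_two W ⟨hgood, by rw [ha]; exact dvd_zero _⟩
  -- lower shape: `g(0) = −4t·h(0)`, so `v₂ g(0) ≥ 2 + v₂ t`
  obtain ⟨t, ht0, ht, g, h, hvg, hg0ne, hgh⟩ := exists_generator_of_oddSignedDivisibility_two W hmod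
    hGZK hgood ha hL h12 d hKim true
    (fun κ γ hκ hγ hγ' _ f hf ϖ hϖ Lp Lm hPP D ↦ by
      simpa only [if_true] using hlow κ γ hκ hγ hγ' f hf ϖ hϖ Lp Lm hPP D)
  simp only [if_true] at hgh
  -- upper shape: `g'(0)·h'(0) = −4t`, so `v₂ g'(0) ≤ 2 + v₂ t` (same valuation `d + v₂∏c + v₂#Ш`)
  obtain ⟨t', ht0', ht', g', h', hvg', hg0ne', hgh'⟩ := exists_generator_of_oddSignedDivisibility_two
    W hmod hGZK hgood ha hL h12 d hKim false
    (fun κ γ hκ hγ hγ' _ f hf ϖ hϖ Lp Lm hPP D ↦ by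
      simpa only [Bool.false_eq_true, if_false] using hup κ γ hκ hγ hγ' f hf ϖ hϖ Lp Lm hPP D)
  simp only [Bool.false_eq_true, if_false] at hgh'
  have htt : t' = t := by
    have := ht'.symm.trans ht
    exact_mod_cast this
  subst htt
  have h4t0 : ((-4 : ℚ) * t' : ℚ) ≠ 0 := mul_ne_zero (by norm_num) ht0
  have htQ : ((((-4 : ℚ) * t' : ℚ) : ℚ_[2])) ≠ 0 := by exact_mod_cast h4t0
  have hh0 : ((PowerSeries.constantCoeff h : ℤ_[2]) : ℚ_[2]) ≠ 0 := fun h0 ↦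
    hg0ne (by rw [hgh, h0, mul_zero])
  have hh0' : ((PowerSeries.constantCoeff h' : ℤ_[2]) : ℚ_[2]) ≠ 0 := fun h0 ↦
    htQ (by rw [← hgh', h0, mul_zero])
  have hval := congrArg Padic.valuation hgh
  rw [Padic.valuation_mul htQ hh0, Padic.valuation_ratCast, hvg] at hval
  have hval' := congrArg Padic.valuation hgh'
  rw [Padic.valuation_mul hg0ne' hh0', Padic.valuation_ratCast, hvg'] at hval'
  have hhnn := valuation_coe_padicInt_nonneg _ hh0
  have hhnn' := valuation_coe_padicInt_nonneg _ hh0'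
  have h4 : padicValRat 2 ((-4 : ℚ) * t') = 2 + padicValRat 2 t' := by
    rw [padicValRat.mul (by norm_num) ht0]
    have : padicValRat 2 (-4 : ℚ) = 2 := by
      rw [show (-4 : ℚ) = -((2 : ℚ) ^ 2) by norm_num, padicValRat.neg, padicValRat.pow,
        show ((2 : ℚ)) = ((2 : ℕ) : ℚ) by norm_num, padicValRat.self (by norm_num)]
      norm_num
    rw [this]
  rw [h4] at hval hval'
  refine ⟨t' * (W.torsionOrder : ℚ) ^ 2 / (W.tamagawaProduct : ℚ),
    shaAn_eq_of_analyticRank_eq_zero W hGZK hr ht', ?_⟩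
  rw [padicValRat_shaAn_witness W 2 hirr ht0]
  linarith

/-- **`d ≠ 2` ⇒ `¬ BSD₂(E)` from the ODD package** (the TYPED OBSTRUCTION): if Kim's identity for `X⁻` at `2` held
with ANY local-defect exponent `d ≠ 2` — in particular VERBATIM as printed for odd `p` (`d = 0`) — then, with the two
odd-sign divisibilities at `2` and PUB, the `2`-part of BSD would FAIL for this `a₂ = 0`, rank-`0` curve
(`v₂ #Ш = v₂ #Ш_an + 2 − d`). The computation attached to the item locates the factor on the algebraic side (`#D⁻ = 4`).
[cite: Miller2011LMS, Def. 1.1] [cite: BDKim2013, Cor. 3.15 (p. 199) and proof p. 200] -/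
theorem not_bsdp_two_of_oddSignedHalves_two
    (hmod : nonempty_modularParametrizationData) (hGZK : rank_eq_analyticRank_of_analyticRank_le_one)
    (hgood : W.HasGoodReductionAtPrime 2) (ha : W.frobeniusTrace 2 = 0) (hL : W.entireLFunction 1 ≠ 0)
    (h12 : ∀ (κ : ZpExtension ℚ 2) (γ : Field.absoluteGaloisGroup ℚ), κ.IsCyclotomic → κ.IsTopGenerator γ →
      ∀ D : SignedSelmerDualData W κ γ (-1), Module.Finite (IwasawaAlgebra 2) D.X ∧ Module.IsTorsion (IwasawaAlgebra 2) D.X)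
    {d : ℕ} (hd : d ≠ 2)
    (hKim : ∀ (κ : ZpExtension ℚ 2) (γ : Field.absoluteGaloisGroup ℚ), κ.IsCyclotomic → κ.IsTopGenerator γ →
      ∀ (D : SignedSelmerDualData W κ γ (-1)) [Module.Finite (IwasawaAlgebra 2) D.X], Module.IsTorsion (IwasawaAlgebra 2) D.X →
      ∀ g : IwasawaAlgebra 2, D.charIdeal = Ideal.span {g} → Finite (W.selmerGroupPInfty 2) →
        ∃ u : ℤ_[2]ˣ, ((PowerSeries.constantCoeff g : ℤ_[2]) : ℚ_[2]) = ((u : ℤ_[2]) : ℚ_[2]) *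
          ((2 : ℕ) : ℚ_[2]) ^ (d + padicValNat 2 W.tamagawaProduct) * (Nat.card (W.selmerGroupPInfty 2) : ℚ_[2]))
    (hlow : KobayashiLowerDivisibility W 2 (-1))
    (hup : ∀ (κ : ZpExtension ℚ 2) (γ : Field.absoluteGaloisGroup ℚ),
      κ.IsCyclotomic → κ.IsTopGenerator γ → IsCyclotomicVariable 2 γ →
      ∀ [NeZero (W.conductorNorm ℤ)] (f : CuspForm (Gamma0 (W.conductorNorm ℤ)) 2), IsNewformOf W f →
      ∀ (ϖ : ℚ), (ϖ : ℝ) * W.realPeriodRat = plusPeriod f → ∀ (Lplus Lminus : IwasawaAlgebra 2), IsPollackPair f 2 Lplus Lminus →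
      ∀ (D : SignedSelmerDualData W κ γ (-1)), ∃ g h : IwasawaAlgebra 2, D.charIdeal = Ideal.span {g} ∧
        iwasawaToPowerSeries 2 (g * h) = PowerSeries.C (ϖ : ℚ_[2]) * iwasawaToPowerSeries 2 (kobayashiL (-1) Lplus Lminus)) :
    ¬ BSDp W 2 := by
  intro hbsd
  have hr : W.analyticRank = 0 := analyticRank_eq_zero_of_entireLFunction_one_ne_zero W hL
  haveI : Finite W.sha := (hGZK W (by omega)).2
  obtain ⟨q, hq, hv⟩ := shaOrder_val_of_oddSignedHalves_two W hmod hGZK hgood ha hL h12 d hKim hlow hup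
  obtain ⟨q', hq', hv'⟩ := missingPPartAt_of_bsdp W 2 hbsd
  have hqq : q' = q := by exact_mod_cast hq'.symm.trans hq
  subst hqq
  rw [hv'] at hv
  have : (d : ℤ) = 2 := by linarith
  exact hd (by exact_mod_cast this)

end OddSign

/-! ## The crux and the odd package: inconsistency of the verbatim transcription, and the odd-sign door -/

section ClassLevel

/-- **The crux REFUTES the verbatim odd-sign package at `2`.** For a non-CM `E = W` of analytic rank `0` with good
supersingular reduction at `2` and `a₂ = 0`: the crux (BSD₂ on the class), PUB {modularity, GZK}, Kobayashi 1.2 for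
`X⁻` at `2`, Kim's Cor. 3.15 for `X⁻` TRANSCRIBED VERBATIM at `2` (`d = 0`) and the two odd-sign halves of the signed
main conjecture at `2` cannot all hold — "`±` at `2` by the same method as for `p > 2`" (Kurihara–Otsuki 2006
p. 557) is SIGN-SENSITIVE; the line `signed-halves-two` uses the EVEN sign. Nothing asserted about any curve.
[cite: KuriharaOtsuki2006, Introduction (p. 557) and Rem. 0.2 (3)] [cite: BDKim2013, Cor. 3.15 (p. 199)] -/
theorem false_of_supersingularRankZeroAtTwo_of_oddSignVerbatim_two
    (hcrux : Summit.BirchSwinnertonDyer.BirchSwinnertonDyer.Theses.ByReductionTypeAtTwo.SupersingularRankZeroAtTwo)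
    (hmod : nonempty_modularParametrizationData) (hGZK : rank_eq_analyticRank_of_analyticRank_le_one)
    (W : WeierstrassCurve ℚ) [W.IsElliptic] [W.IsGloballyMinimal]
    (hcm : ¬ W.HasCM) (hr : W.analyticRank = 0) (hss : GoodSS W 2) (ha : W.frobeniusTrace 2 = 0)
    (h12 : ∀ (κ : ZpExtension ℚ 2) (γ : Field.absoluteGaloisGroup ℚ), κ.IsCyclotomic → κ.IsTopGenerator γ →
      ∀ D : SignedSelmerDualData W κ γ (-1), Module.Finite (IwasawaAlgebra 2) D.X ∧ Module.IsTorsion (IwasawaAlgebra 2) D.X)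
    (hKimVerbatim : ∀ (κ : ZpExtension ℚ 2) (γ : Field.absoluteGaloisGroup ℚ), κ.IsCyclotomic → κ.IsTopGenerator γ →
      ∀ (D : SignedSelmerDualData W κ γ (-1)) [Module.Finite (IwasawaAlgebra 2) D.X], Module.IsTorsion (IwasawaAlgebra 2) D.X →
      ∀ g : IwasawaAlgebra 2, D.charIdeal = Ideal.span {g} → Finite (W.selmerGroupPInfty 2) →
        ∃ u : ℤ_[2]ˣ, ((PowerSeries.constantCoeff g : ℤ_[2]) : ℚ_[2]) = ((u : ℤ_[2]) : ℚ_[2]) *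
          ((2 : ℕ) : ℚ_[2]) ^ (padicValNat 2 W.tamagawaProduct) * (Nat.card (W.selmerGroupPInfty 2) : ℚ_[2]))
    (hlow : KobayashiLowerDivisibility W 2 (-1))
    (hup : ∀ (κ : ZpExtension ℚ 2) (γ : Field.absoluteGaloisGroup ℚ),
      κ.IsCyclotomic → κ.IsTopGenerator γ → IsCyclotomicVariable 2 γ →
      ∀ [NeZero (W.conductorNorm ℤ)] (f : CuspForm (Gamma0 (W.conductorNorm ℤ)) 2), IsNewformOf W f →
      ∀ (ϖ : ℚ), (ϖ : ℝ) * W.realPeriodRat = plusPeriod f → ∀ (Lplus Lminus : IwasawaAlgebra 2), IsPollackPair f 2 Lplus Lminus →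
      ∀ (D : SignedSelmerDualData W κ γ (-1)), ∃ g h : IwasawaAlgebra 2, D.charIdeal = Ideal.span {g} ∧
        iwasawaToPowerSeries 2 (g * h) = PowerSeries.C (ϖ : ℚ_[2]) * iwasawaToPowerSeries 2 (kobayashiL (-1) Lplus Lminus)) :
    False := by
  have hL : W.entireLFunction 1 ≠ 0 := entireLFunction_one_ne_zero_of_analyticRank_eq_zero W hmod hr
  refine not_bsdp_two_of_oddSignedHalves_two W hmod hGZK hss.1 ha hL h12 (d := 0) (by decide)
    (fun κ γ hκ hγ D _ hT g hg hfin ↦ ?_) hlow hup (hcrux W hcm hr hss)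
  simpa only [zero_add] using hKimVerbatim κ γ hκ hγ D hT g hg hfin

/-- **THE ODD-SIGN DOOR (class level).** The crux from PUB {modularity, GZK} + on `a₂ = 0` the ODD package WITH
local defect `#D⁻ = 4` {Kobayashi 1.2 for `X⁻` at `2`, Kim's identity with `d = 2`, `KobayashiLowerDivisibility W 2 (-1)`,
the odd Kato-side divisibility at `2`} + on `a₂ = ±2` the two Miller halves (MATH-BOUND). Companion of
`supersingularRankZeroAtTwo_of_signedHalves_two` (even sign, `d = 0`); composition certificate, nothing asserted.
[cite: Kobayashi2003, Thm. 1.2 and Conjecture (p. 2)] [cite: BDKim2013, Cor. 3.15 (p. 199)] [cite: Miller2011LMS, Def. 1.1] -/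
theorem supersingularRankZeroAtTwo_of_oddSignedHalves_two
    (hmod : nonempty_modularParametrizationData) (hGZK : rank_eq_analyticRank_of_analyticRank_le_one)
    (h12 : ∀ (W : WeierstrassCurve ℚ) [W.IsElliptic] [W.IsGloballyMinimal],
      ¬ W.HasCM → W.analyticRank = 0 → GoodSS W 2 → W.frobeniusTrace 2 = 0 →
      ∀ (κ : ZpExtension ℚ 2) (γ : Field.absoluteGaloisGroup ℚ), κ.IsCyclotomic → κ.IsTopGenerator γ →
        ∀ D : SignedSelmerDualData W κ γ (-1), Module.Finite (IwasawaAlgebra 2) D.X ∧ Module.IsTorsion (IwasawaAlgebra 2) D.X)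
    (hKim : ∀ (W : WeierstrassCurve ℚ) [W.IsElliptic] [W.IsGloballyMinimal],
      ¬ W.HasCM → W.analyticRank = 0 → GoodSS W 2 → W.frobeniusTrace 2 = 0 →
      ∀ (κ : ZpExtension ℚ 2) (γ : Field.absoluteGaloisGroup ℚ), κ.IsCyclotomic → κ.IsTopGenerator γ →
        ∀ (D : SignedSelmerDualData W κ γ (-1)) [Module.Finite (IwasawaAlgebra 2) D.X], Module.IsTorsion (IwasawaAlgebra 2) D.X →
        ∀ g : IwasawaAlgebra 2, D.charIdeal = Ideal.span {g} → Finite (W.selmerGroupPInfty 2) →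
          ∃ u : ℤ_[2]ˣ, ((PowerSeries.constantCoeff g : ℤ_[2]) : ℚ_[2]) = ((u : ℤ_[2]) : ℚ_[2]) *
            ((2 : ℕ) : ℚ_[2]) ^ (2 + padicValNat 2 W.tamagawaProduct) * (Nat.card (W.selmerGroupPInfty 2) : ℚ_[2]))
    (hlow : ∀ (W : WeierstrassCurve ℚ) [W.IsElliptic] [W.IsGloballyMinimal],
      ¬ W.HasCM → W.analyticRank = 0 → GoodSS W 2 → W.frobeniusTrace 2 = 0 → KobayashiLowerDivisibility W 2 (-1))
    (hup : ∀ (W : WeierstrassCurve ℚ) [W.IsElliptic] [W.IsGloballyMinimal],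
      ¬ W.HasCM → W.analyticRank = 0 → GoodSS W 2 → W.frobeniusTrace 2 = 0 →
      ∀ (κ : ZpExtension ℚ 2) (γ : Field.absoluteGaloisGroup ℚ),
        κ.IsCyclotomic → κ.IsTopGenerator γ → IsCyclotomicVariable 2 γ →
        ∀ [NeZero (W.conductorNorm ℤ)] (f : CuspForm (Gamma0 (W.conductorNorm ℤ)) 2), IsNewformOf W f →
        ∀ (ϖ : ℚ), (ϖ : ℝ) * W.realPeriodRat = plusPeriod f → ∀ (Lplus Lminus : IwasawaAlgebra 2), IsPollackPair f 2 Lplus Lminus →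
        ∀ (D : SignedSelmerDualData W κ γ (-1)), ∃ g h : IwasawaAlgebra 2, D.charIdeal = Ideal.span {g} ∧
          iwasawaToPowerSeries 2 (g * h) = PowerSeries.C (ϖ : ℚ_[2]) * iwasawaToPowerSeries 2 (kobayashiL (-1) Lplus Lminus))
    (hL2 : ∀ (W : WeierstrassCurve ℚ) [W.IsElliptic] [W.IsGloballyMinimal],
      ¬ W.HasCM → W.analyticRank = 0 → GoodSS W 2 →
        (W.frobeniusTrace 2 = 2 ∨ W.frobeniusTrace 2 = -2) → MissingLowerBoundAt W 2)
    (hU2 : ∀ (W : WeierstrassCurve ℚ) [W.IsElliptic] [W.IsGloballyMinimal],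
      ¬ W.HasCM → W.analyticRank = 0 → GoodSS W 2 →
        (W.frobeniusTrace 2 = 2 ∨ W.frobeniusTrace 2 = -2) → MissingUpperBoundAt W 2) :
    Summit.BirchSwinnertonDyer.BirchSwinnertonDyer.Theses.ByReductionTypeAtTwo.SupersingularRankZeroAtTwo := by
  unfold Summit.BirchSwinnertonDyer.BirchSwinnertonDyer.Theses.ByReductionTypeAtTwo.SupersingularRankZeroAtTwo
  intro W _ _ hcm hr hss
  refine bsdp_of_missingPPartAt W 2 hGZK (by omega) ?_
  rcases frobeniusTrace_two_eq_zero_or W hss.1 hss.2 with ha | ha2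
  · have hL : W.entireLFunction 1 ≠ 0 := entireLFunction_one_ne_zero_of_analyticRank_eq_zero W hmod hr
    obtain ⟨q, hq, hv⟩ := shaOrder_val_of_oddSignedHalves_two W hmod hGZK hss.1 ha hL
      (h12 W hcm hr hss ha) 2 (hKim W hcm hr hss ha) (hlow W hcm hr hss ha) (hup W hcm hr hss ha)
    exact ⟨q, hq, by simp only [Nat.cast_ofNat] at hv; linarith⟩
  · exact missingPPartAt_of_lower_of_upper W 2 (hL2 W hcm hr hss ha2) (hU2 W hcm hr hss ha2)

end ClassLevel

end Summit.BirchSwinnertonDyer.BirchSwinnertonDyer.Theorems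

end
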